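import Literature.AlgebraicGeometry.Resolution.Henselization
import Literature.AlgebraicGeometry.Resolution.CompositeValuationsCofinal
import Literature.AlgebraicGeometry.Resolution.ValuationOverrings
import HarnessLib

/-!
# The henselization is antitone in the valuation ring: `E^{h(Q)} ⊆ E^{h(P)}` for a coarsening `Q` of `P`

Topic: `Literature/AlgebraicGeometry/Resolution` (valued function fields). Glue for the proof of
F.-V. Kuhlmann, *Elimination of ramification II: Henselian rationality*, Israel J. Math. 234
(2019) = arXiv:1701.05508, **Prop. 5.6** (`Kuhlmann2019HenselianRationalityFiniteRankProofs.lean`),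
where henselizations of one field with respect to a place `P = P₁P₂P₃` and its coarsenings
`P₁`, `P₁P₂` are compared ("`(F^{h(P)}, P₁P₂)` is henselian, so it must contain
`F^{h(P₁P₂)}`", p. 13, via Lemma 5.5 (b)). In the ambient rendering of `Henselization.lean` —
one valued field `(Ω, V)`, `E^h = henselization V E` the fixed field of the decomposition group
`{σ ∈ Gal(E^{sep}|E) : σ(V ∩ E^{sep}) = V ∩ E^{sep}}` — a coarsening of `V ∩ E` is `W ∩ E` for
an overring `W ≥ V` of `V` in `Ω`, and the inclusion `henselization W E ≤ henselization V E`
follows from the inclusion of decomposition groups `D_V ≤ D_W`, which in turn is the following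
piece of folklore (Zariski–Samuel II, Ch. VI §7; Engler–Prestel, *Valued Fields*, §3.2): **in
an algebraic extension, two overrings of one valuation ring with the same trace on the base
field coincide** (the convex subgroups of `vL'` correspond bijectively to those of `vL` when
`vL'/vL` is torsion). Indeed `σ(W ∩ E^{sep})` and `W ∩ E^{sep}` are both overrings of
`σ(V ∩ E^{sep}) = V ∩ E^{sep}` with trace `W ∩ E`.

## Content (everything PROVED, [folklore])

* `ValuationSubring.eq_of_le_of_le_of_forall_mem_iff` — for a field `L'` algebraic over a
  subfield `E`, valuation rings `O₁, O₂ ≥ U` of `L'` with `O₁ ∩ E = O₂ ∩ E` are equal (if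
  `y ∈ O₂ ∖ O₁`, some `yⁿ`, `n ≥ 1`, has the `U`-value of an `e ∈ E`; then `e ∈ O₂ ∩ E = O₁ ∩ E`
  and `yⁿ ∈ O₁`, so `y ∈ O₁`).
* `decompositionGroup_mono` — `V ≤ W ⇒ D_V(E) ≤ D_W(E)`.
* `henselization_antitone` — `V ≤ W ⇒ henselization W E ≤ henselization V E`.
* `IsImmediateOver.valuation_of_le` — the value half of "immediate" passes to coarsenings
  (Lemma 5.5 (a) of the source: "`v_{P₁}F = v_{P₁}K`" for an immediate `(F|K, P)`).

## Sources

* F.-V. Kuhlmann, Israel J. Math. 234 (2019) = arXiv:1701.05508: Lemma 5.5 (a), (b) and the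
  proof of Prop. 5.6 (p. 13).
* O. Zariski, P. Samuel, *Commutative Algebra* II (1960), Ch. VI §7 (extensions of valuations
  to algebraic extensions), §10 (convex subgroups and overrings).
-/

noncomputable section

open IsLocalRing
open scoped Pointwise

namespace Literature.AlgebraicGeometry.Resolution

universe u

/-! ### Overrings in an algebraic extension are determined by their trace on the base -/

section Trace

variable {L : Type*} [Field L]

/-- **In an algebraic extension, overrings of one valuation ring are determined by their trace
on the base field**: if every element of `L` is algebraic over the subfield `E`, `U ≤ O₁`,
`U ≤ O₂` are valuation subrings of `L`, and `O₁ ∩ E = O₂ ∩ E`, then `O₁ = O₂`. (The overrings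
of `U` are totally ordered; if `O₁ ≤ O₂` and `y ∈ O₂ ∖ O₁`, then `v_U(yⁿ) = v_U(e)` for some
`n ≥ 1`, `e ∈ E^×` — values of algebraic elements are torsion modulo the values of `E` —, so
`e = yⁿ·(e/yⁿ) ∈ O₂ ∩ E = O₁ ∩ E` and `yⁿ = e·(yⁿ/e) ∈ O₁`, whence `y ∈ O₁`.) [folklore] -/
theorem ValuationSubring.eq_of_le_of_le_of_forall_mem_iff (E : Subfield L)
    (halg : ∀ y : L, IsAlgebraic E y) {U O₁ O₂ : ValuationSubring L} (h₁ : U ≤ O₁) (h₂ : U ≤ O₂)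
    (h : ∀ e ∈ E, e ∈ O₁ ↔ e ∈ O₂) : O₁ = O₂ := by
  wlog hle : O₁ ≤ O₂ generalizing O₁ O₂
  · exact (this h₂ h₁ (fun e he => (h e he).symm)
      ((overring_le_or_ge h₁ h₂).resolve_left hle)).symm
  refine le_antisymm hle fun y hy => ?_
  by_contra hy₁
  have hy0 : y ≠ 0 := fun h0 => hy₁ (h0 ▸ O₁.zero_mem)
  obtain ⟨n, hn, e, heE, he0, hval⟩ := exists_pow_valuation_eq_of_isAlgebraic U E hy0 (halg y)
  have hyn0 : y ^ n ≠ 0 := pow_ne_zero n hy0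
  have hve : U.valuation e ≠ 0 := (map_ne_zero _).mpr he0
  have hvy : U.valuation (y ^ n) ≠ 0 := (map_ne_zero _).mpr hyn0
  -- `e / yⁿ` and `yⁿ / e` are units of `U`
  have hq : e / y ^ n ∈ U := by
    rw [← U.valuation_le_one_iff, map_div₀, hval, div_self hve]
  have hq' : y ^ n / e ∈ U := by
    rw [← U.valuation_le_one_iff, map_div₀, hval, div_self hve]
  have heO₂ : e ∈ O₂ := by
    have : e = y ^ n * (e / y ^ n) := by field_simp
    rw [this]
    exact mul_mem (pow_mem hy n) (h₂ hq)
  have heO₁ : e ∈ O₁ := (h e heE).mpr heO₂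
  have hyn : y ^ n ∈ O₁ := by
    have : y ^ n = e * (y ^ n / e) := by field_simp
    rw [this]
    exact mul_mem heO₁ (h₁ hq')
  -- valuation rings are closed under `n`-th roots
  apply hy₁
  rw [← O₁.valuation_le_one_iff] at hyn ⊢
  rw [map_pow] at hyn
  exact (pow_le_one_iff hn.ne').mp hyn

end Trace

/-! ### Decomposition groups and henselizations along a coarsening `V ≤ W` -/

section Antitone

variable {Ω : Type u} [Field Ω] (E : Subfield Ω)

/-- `V ≤ W ⇒ V ∩ E^{sep} ≤ W ∩ E^{sep}`. [folklore] -/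
theorem sepClosureValuationSubring_mono {V W : ValuationSubring Ω} (hVW : V ≤ W) :
    sepClosureValuationSubring V E ≤ sepClosureValuationSubring W E := fun _ hx => hVW hx

/-- Elements of `E^{sep}` are algebraic over (the image of) `E`. [folklore] -/
theorem isAlgebraic_fieldRange_separableClosure (y : separableClosure E Ω) :
    IsAlgebraic (algebraMap E (separableClosure E Ω)).fieldRange y := by
  have hy : IsAlgebraic E y := Algebra.IsAlgebraic.isAlgebraic y
  exact hy.ringHom_of_comp_eq (algebraMap E (separableClosure E Ω)).rangeRestrictField
    (RingHom.id (separableClosure E Ω))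
    (algebraMap E (separableClosure E Ω)).rangeRestrictField_bijective.injective
    (RingHom.ext fun _ => rfl)

/-- **The decomposition group only grows under coarsening**: for `V ≤ W`, every
`σ ∈ Gal(E^{sep}|E)` with `σ(V ∩ E^{sep}) = V ∩ E^{sep}` satisfies
`σ(W ∩ E^{sep}) = W ∩ E^{sep}` — both sides are overrings of `V ∩ E^{sep}` with trace `W ∩ E`
on `E` (`ValuationSubring.eq_of_le_of_le_of_forall_mem_iff`). [folklore] -/
theorem decompositionGroup_mono {V W : ValuationSubring Ω} (hVW : V ≤ W) :
    decompositionGroup V E ≤ decompositionGroup W E := by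
  intro σ hσ
  rw [mem_decompositionGroup_iff] at hσ ⊢
  refine ValuationSubring.eq_of_le_of_le_of_forall_mem_iff
    (algebraMap E (separableClosure E Ω)).fieldRange (isAlgebraic_fieldRange_separableClosure E)
    (U := sepClosureValuationSubring V E) ?_ (sepClosureValuationSubring_mono E hVW) ?_
  · rw [← hσ]
    exact ValuationSubring.pointwise_smul_le_pointwise_smul_iff.mpr
      (sepClosureValuationSubring_mono E hVW)
  · rintro _ ⟨c, rfl⟩
    rw [ValuationSubring.mem_pointwise_smul_iff_inv_smul_mem, AlgEquiv.smul_def, AlgEquiv.commutes]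

/-- **The henselization is antitone in the valuation ring**: for a coarsening `W ≥ V`,
`henselization W E ≤ henselization V E` (the fixed field of the larger group `D_W ≥ D_V` is
smaller). This is the containment "`F^{h(P₁P₂)} ⊆ F^{h(P)}`" of Kuhlmann 2019, proof of
Prop. 5.6, there obtained from Lemma 5.5 (b). [cite: Kuhlmann2019, Lemma 5.5 (b) and Prop. 5.6 (proof)] -/
theorem henselization_antitone {V W : ValuationSubring Ω} (hVW : V ≤ W) :
    henselization W E ≤ henselization V E := by
  intro x hx
  rw [mem_henselization_iff] at hx ⊢
  obtain ⟨hxs, hfix⟩ := hx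
  exact ⟨hxs, fun σ hσ => hfix σ (decompositionGroup_mono E hVW hσ)⟩

end Antitone

/-! ### Values along a coarsening -/

section Values

variable {Ω : Type u} [Field Ω]

/-- **Lemma 5.5 (a), value part: "`v_{P₁}F = v_{P₁}K`" for an immediate `(F|K, P)`** — if
every `V`-value of `F^×` is a `V`-value of `K`, the same holds for the `W`-values, `W ≥ V`.
PROVED. [cite: Kuhlmann2019, Lemma 5.5 (a)] -/
theorem IsImmediateOver.valuation_of_le {V W : ValuationSubring Ω} (hVW : V ≤ W) {K F : Subfield Ω}
    (h : IsImmediateOver V K F) :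
    ∀ a ∈ F, a ≠ 0 → ∃ b ∈ K, W.valuation a = W.valuation b := fun a ha ha0 =>
  let ⟨b, hbK, hab⟩ := h.1 a ha ha0
  ⟨b, hbK, le_antisymm (valuation_le_valuation_of_le hVW hab.le)
    (valuation_le_valuation_of_le hVW hab.ge)⟩

end Values

end Literature.AlgebraicGeometry.Resolution
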